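import Literature.MathematicalPhysics.QuantumLattice.MatsubaraTruncationConvergence
import HarnessLib

/-!
# The seeded (Nambu–Gor'kov) propagator as a BCS combination of one-mode propagators, and its `M → ∞` limit

Topic `Literature/MathematicalPhysics/QuantumLattice`; the `M → ∞` bridge for the covariance actually used by the
tree's Grassmann representation of the `d`-wave–seeded Hubbard torus (`HubbardFreeCovariance.nambuPropagator`,
`G(k) = (-iω + M(k⃗))⁻¹ = (iω + M(k⃗))/(ω² + ξ² + Δ²)`, `M = [[ξ, Δ],[Δ, -ξ]]`, `Δ = hφ_d(k⃗)`).  With the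
quasi-particle energy `E = √(ξ² + Δ²)` and the BCS coherence weights `u² = ½(1 + ξ/E)`, `v² = ½(1 − ξ/E)`:

* `nambuPropagator_apply_zero_zero` / `_one_one` / `_zero_one` / `_one_zero` — the ENTRYWISE decomposition
  `G₁₁ = u²/(-iω + E) + v²/(-iω − E)`, `G₂₂ = v²/(-iω + E) + u²/(-iω − E)`,
  `G₁₂ = G₂₁ = (Δ/2E)(1/(-iω + E) − 1/(-iω − E))` (valid also at `E = 0` with Lean's `x/0 = 0`);
* `tendsto_weightedPair_bgm_of_mem_Ioo(_neg)`, `norm_weightedPair_bgm_le` — limit and uniform bound of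
  `(1/β) Σᵢ e^{-iωᵢτ}(a/(-iωᵢ + E) + b/(-iωᵢ − E))` from `MatsubaraTruncationConvergence` (`0 < τ < β`:
  `a (1+e^{-βE})⁻¹e^{-Eτ} + b (1+e^{βE})⁻¹e^{Eτ}`; `-β < τ < 0`: minus the same with `E ↔ -E` in the Fermi factors);
* `tendsto_nambuPropagator_zero_zero_of_mem_Ioo` etc. — hence the truncated frequency sums of every entry of
  `G(·, k⃗)` converge boundedly (`‖·‖ ≤ 2(2 + βE/3)`) to the imaginary-time-ordered BCS two-point functions, e.g.
  `(1/β) Σᵢ e^{-iωᵢτ} G₁₁(ωᵢ,k⃗) → u²(1 − n_F(E))e^{-Eτ} + v² n_F(E) e^{Eτ}` for `0 < τ < β`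
  (`= ⟨a_{k↑}(τ)a⁺_{k↑}(0)⟩` of the BdG quasi-free state).

Everything is proved; no definitions, no named facts.

## Sources

G. Benfatto, A. Giuliani, V. Mastropietro, Ann. Henri Poincaré 7 (2006) 809–898, §2.1 (2.2)–(2.4)
[`BenfattoGiulianiMastropietro2006`]; A. L. Fetter, J. D. Walecka, *Quantum Theory of Many-Particle Systems*
(1971), §51 (Nambu–Gor'kov propagator, coherence factors `u², v²`). [folklore]
-/

noncomputable section

namespace Literature.MathematicalPhysics.QuantumLattice

open Finset Filter Complex _root_.Topology Literature.Probability.LatticeModels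
open scoped Real

/-! ### The BCS decomposition of the entries -/

section Algebra

variable {L M : ℕ}

/-- `E · (ξ/E) = ξ` for `E = √(ξ² + Δ²)` (if `E = 0` then `ξ = 0`). [folklore] -/
theorem sqrt_mul_div_sqrt_self (ξ Δ : ℝ) :
    Real.sqrt (ξ ^ 2 + Δ ^ 2) * (ξ / Real.sqrt (ξ ^ 2 + Δ ^ 2)) = ξ := by
  rcases eq_or_ne (Real.sqrt (ξ ^ 2 + Δ ^ 2)) 0 with h | h
  · rw [h, zero_mul]
    rw [Real.sqrt_eq_zero (by positivity)] at h
    nlinarith [sq_nonneg ξ, sq_nonneg Δ]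
  · field_simp

/-- `E · (Δ/E) = Δ` for `E = √(ξ² + Δ²)` (if `E = 0` then `Δ = 0`). [folklore] -/
theorem sqrt_mul_div_sqrt_self' (ξ Δ : ℝ) :
    Real.sqrt (ξ ^ 2 + Δ ^ 2) * (Δ / Real.sqrt (ξ ^ 2 + Δ ^ 2)) = Δ := by
  rcases eq_or_ne (Real.sqrt (ξ ^ 2 + Δ ^ 2)) 0 with h | h
  · rw [h, zero_mul]
    rw [Real.sqrt_eq_zero (by positivity)] at h
    nlinarith [sq_nonneg ξ, sq_nonneg Δ]
  · field_simp

/-- `Δ = 0` when `E = √(ξ² + Δ²) = 0`. [folklore] -/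
theorem eq_zero_of_sqrt_sq_add_sq_eq_zero {ξ Δ : ℝ} (h : Real.sqrt (ξ ^ 2 + Δ ^ 2) = 0) : Δ = 0 := by
  rw [Real.sqrt_eq_zero (by positivity)] at h
  nlinarith [sq_nonneg ξ, sq_nonneg Δ]

/-- The BCS denominator is `ω² + E²`: `nambuDen = ω² + (√(ξ² + Δ²))²`. [folklore] -/
theorem nambuDen_eq_sq_add_sq (β μ h : ℝ) (k : FreqMomentum L M) :
    nambuDen L M β μ h k = matsubaraFreq β M k.1 ^ 2 +
      Real.sqrt (nambuXi L μ k.2 ^ 2 + (h * dWaveSymbol L k.2) ^ 2) ^ 2 := by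
  rw [nambuDen, Real.sq_sqrt (by positivity), add_assoc]

/-- `1/(-iω + E) = (iω + E)/(ω² + E²)` (`ω ≠ 0`). [folklore] -/
theorem one_div_neg_I_mul_add (ω E : ℝ) (hω : ω ≠ 0) :
    (1 : ℂ) / (-(I * ω) + E) = (I * ω + E) / ((ω ^ 2 + E ^ 2 : ℝ) : ℂ) := by
  have hne : (-(I * (ω : ℂ)) + E) ≠ 0 := by
    intro h0
    have := congrArg Complex.im h0
    simp at this
    exact hω this
  have hD : ((ω ^ 2 + E ^ 2 : ℝ) : ℂ) ≠ 0 := by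
    have : (0 : ℝ) < ω ^ 2 + E ^ 2 := by positivity
    exact_mod_cast this.ne'
  rw [div_eq_div_iff hne hD, one_mul]
  push_cast
  ring_nf
  rw [I_sq]
  ring

/-- **The weighted pair equals the Nambu entry**: for reals `ω ≠ 0`, `ξ`, `Δ`, `E = √(ξ² + Δ²)` and weights
`a, b`: `a/(-iω + E) + b/(-iω − E) = (iω(a + b) + E(a − b))/(ω² + ξ² + Δ²)`. [folklore] -/
theorem weightedPair_eq_div (ω ξ Δ a b : ℝ) (hω : ω ≠ 0) :
    (a : ℂ) * (1 / (-(I * ω) + Real.sqrt (ξ ^ 2 + Δ ^ 2))) +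
        (b : ℂ) * (1 / (-(I * ω) + ((-Real.sqrt (ξ ^ 2 + Δ ^ 2) : ℝ) : ℂ))) =
      (I * ω * (a + b) + Real.sqrt (ξ ^ 2 + Δ ^ 2) * (a - b)) / ((ω ^ 2 + ξ ^ 2 + Δ ^ 2 : ℝ) : ℂ) := by
  set E := Real.sqrt (ξ ^ 2 + Δ ^ 2) with hE
  have hE2 : E ^ 2 = ξ ^ 2 + Δ ^ 2 := by rw [hE, Real.sq_sqrt (by positivity)]
  have hden : ((ω ^ 2 + ξ ^ 2 + Δ ^ 2 : ℝ) : ℂ) = ((ω ^ 2 + E ^ 2 : ℝ) : ℂ) := by rw [hE2, add_assoc]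
  have hden' : ((ω ^ 2 + (-E) ^ 2 : ℝ) : ℂ) = ((ω ^ 2 + E ^ 2 : ℝ) : ℂ) := by rw [neg_sq]
  rw [one_div_neg_I_mul_add ω E hω, one_div_neg_I_mul_add ω (-E) hω, hden', hden]
  have hD : ((ω ^ 2 + E ^ 2 : ℝ) : ℂ) ≠ 0 := by
    have : (0 : ℝ) < ω ^ 2 + E ^ 2 := by positivity
    exact_mod_cast this.ne'
  field_simp
  push_cast
  ring

/-- Extracting the entries of `nambuPropagator`. [folklore] -/
theorem nambuPropagator_apply (β μ h : ℝ) (k : FreqMomentum L M) :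
    nambuPropagator L M β μ h k 0 0 = (I * matsubaraFreq β M k.1 + nambuXi L μ k.2) / nambuDen L M β μ h k ∧
    nambuPropagator L M β μ h k 0 1 = ((h * dWaveSymbol L k.2 : ℝ) : ℂ) / nambuDen L M β μ h k ∧
    nambuPropagator L M β μ h k 1 0 = ((h * dWaveSymbol L k.2 : ℝ) : ℂ) / nambuDen L M β μ h k ∧
    nambuPropagator L M β μ h k 1 1 = (I * matsubaraFreq β M k.1 - nambuXi L μ k.2) / nambuDen L M β μ h k := by
  simp [nambuPropagator]

/-- **BCS decomposition of `G₁₁`**: `G₁₁(ω, k⃗) = u²/(-iω + E) + v²/(-iω − E)` with `E = √(ξ² + Δ²)`,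
`u² = ½(1 + ξ/E)`, `v² = ½(1 − ξ/E)` (`β ≠ 0`; Fetter–Walecka §51). [folklore] -/
theorem nambuPropagator_apply_zero_zero {β : ℝ} (hβ : β ≠ 0) (μ h : ℝ) (k : FreqMomentum L M) :
    nambuPropagator L M β μ h k 0 0 =
      (((1 + nambuXi L μ k.2 / Real.sqrt (nambuXi L μ k.2 ^ 2 + (h * dWaveSymbol L k.2) ^ 2)) / 2 : ℝ) : ℂ) *
          (1 / (-(I * matsubaraFreq β M k.1) + Real.sqrt (nambuXi L μ k.2 ^ 2 + (h * dWaveSymbol L k.2) ^ 2))) +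
        (((1 - nambuXi L μ k.2 / Real.sqrt (nambuXi L μ k.2 ^ 2 + (h * dWaveSymbol L k.2) ^ 2)) / 2 : ℝ) : ℂ) *
          (1 / (-(I * matsubaraFreq β M k.1) +
            ((-Real.sqrt (nambuXi L μ k.2 ^ 2 + (h * dWaveSymbol L k.2) ^ 2) : ℝ) : ℂ))) := by
  have hω := matsubaraFreq_ne_zero (M := M) hβ k.1
  rw [(nambuPropagator_apply β μ h k).1, weightedPair_eq_div _ (nambuXi L μ k.2) (h * dWaveSymbol L k.2) _ _ hω,
    nambuDen]
  congr 1
  have hs := sqrt_mul_div_sqrt_self (nambuXi L μ k.2) (h * dWaveSymbol L k.2)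
  set E := Real.sqrt (nambuXi L μ k.2 ^ 2 + (h * dWaveSymbol L k.2) ^ 2)
  set ξ := nambuXi L μ k.2
  have h1 : ((1 + ξ / E) / 2 + (1 - ξ / E) / 2 : ℝ) = 1 := by ring
  have h2 : (E * ((1 + ξ / E) / 2 - (1 - ξ / E) / 2) : ℝ) = ξ := by
    rw [show (1 + ξ / E) / 2 - (1 - ξ / E) / 2 = ξ / E by ring]; exact hs
  have h1' : (((1 + ξ / E) / 2 : ℝ) : ℂ) + (((1 - ξ / E) / 2 : ℝ) : ℂ) = 1 := by exact_mod_cast h1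
  have h2' : (E : ℂ) * ((((1 + ξ / E) / 2 : ℝ) : ℂ) - (((1 - ξ / E) / 2 : ℝ) : ℂ)) = ξ := by exact_mod_cast h2
  rw [h1', h2', mul_one]

/-- **BCS decomposition of `G₂₂`**: `G₂₂(ω, k⃗) = v²/(-iω + E) + u²/(-iω − E)`. [folklore] -/
theorem nambuPropagator_apply_one_one {β : ℝ} (hβ : β ≠ 0) (μ h : ℝ) (k : FreqMomentum L M) :
    nambuPropagator L M β μ h k 1 1 =
      (((1 - nambuXi L μ k.2 / Real.sqrt (nambuXi L μ k.2 ^ 2 + (h * dWaveSymbol L k.2) ^ 2)) / 2 : ℝ) : ℂ) *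
          (1 / (-(I * matsubaraFreq β M k.1) + Real.sqrt (nambuXi L μ k.2 ^ 2 + (h * dWaveSymbol L k.2) ^ 2))) +
        (((1 + nambuXi L μ k.2 / Real.sqrt (nambuXi L μ k.2 ^ 2 + (h * dWaveSymbol L k.2) ^ 2)) / 2 : ℝ) : ℂ) *
          (1 / (-(I * matsubaraFreq β M k.1) +
            ((-Real.sqrt (nambuXi L μ k.2 ^ 2 + (h * dWaveSymbol L k.2) ^ 2) : ℝ) : ℂ))) := by
  have hω := matsubaraFreq_ne_zero (M := M) hβ k.1
  rw [(nambuPropagator_apply β μ h k).2.2.2, weightedPair_eq_div _ (nambuXi L μ k.2) (h * dWaveSymbol L k.2) _ _ hω,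
    nambuDen]
  congr 1
  have hs := sqrt_mul_div_sqrt_self (nambuXi L μ k.2) (h * dWaveSymbol L k.2)
  set E := Real.sqrt (nambuXi L μ k.2 ^ 2 + (h * dWaveSymbol L k.2) ^ 2)
  set ξ := nambuXi L μ k.2
  have h1 : ((1 - ξ / E) / 2 + (1 + ξ / E) / 2 : ℝ) = 1 := by ring
  have h2 : (E * ((1 - ξ / E) / 2 - (1 + ξ / E) / 2) : ℝ) = -ξ := by
    rw [show (1 - ξ / E) / 2 - (1 + ξ / E) / 2 = -(ξ / E) by ring, mul_neg, hs]
  have h1' : (((1 - ξ / E) / 2 : ℝ) : ℂ) + (((1 + ξ / E) / 2 : ℝ) : ℂ) = 1 := by exact_mod_cast h1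
  have h2' : (E : ℂ) * ((((1 - ξ / E) / 2 : ℝ) : ℂ) - (((1 + ξ / E) / 2 : ℝ) : ℂ)) = -ξ := by exact_mod_cast h2
  rw [h1', h2', mul_one, sub_eq_add_neg]

/-- **BCS decomposition of the anomalous entry**: `G₁₂(ω, k⃗) = (Δ/2E)(1/(-iω + E) − 1/(-iω − E))`,
`Δ = hφ_d(k⃗)` (at `E = 0`, where `Δ = 0`, both sides vanish). [folklore] -/
theorem nambuPropagator_apply_zero_one {β : ℝ} (hβ : β ≠ 0) (μ h : ℝ) (k : FreqMomentum L M) :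
    nambuPropagator L M β μ h k 0 1 =
      ((h * dWaveSymbol L k.2 / (2 * Real.sqrt (nambuXi L μ k.2 ^ 2 + (h * dWaveSymbol L k.2) ^ 2)) : ℝ) : ℂ) *
          (1 / (-(I * matsubaraFreq β M k.1) + Real.sqrt (nambuXi L μ k.2 ^ 2 + (h * dWaveSymbol L k.2) ^ 2))) +
        ((-(h * dWaveSymbol L k.2 / (2 * Real.sqrt (nambuXi L μ k.2 ^ 2 + (h * dWaveSymbol L k.2) ^ 2))) : ℝ) : ℂ) *
          (1 / (-(I * matsubaraFreq β M k.1) +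
            ((-Real.sqrt (nambuXi L μ k.2 ^ 2 + (h * dWaveSymbol L k.2) ^ 2) : ℝ) : ℂ))) := by
  have hω := matsubaraFreq_ne_zero (M := M) hβ k.1
  rw [(nambuPropagator_apply β μ h k).2.1, weightedPair_eq_div _ (nambuXi L μ k.2) (h * dWaveSymbol L k.2) _ _ hω,
    nambuDen]
  congr 1
  have hs := sqrt_mul_div_sqrt_self' (nambuXi L μ k.2) (h * dWaveSymbol L k.2)
  set E := Real.sqrt (nambuXi L μ k.2 ^ 2 + (h * dWaveSymbol L k.2) ^ 2) with hE
  set Δ := h * dWaveSymbol L k.2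
  have h1 : (Δ / (2 * E) + -(Δ / (2 * E)) : ℝ) = 0 := by ring
  have h2 : (E * (Δ / (2 * E) - -(Δ / (2 * E))) : ℝ) = Δ := by
    rw [show Δ / (2 * E) - -(Δ / (2 * E)) = Δ / E by ring]; exact hs
  have h1' : ((Δ / (2 * E) : ℝ) : ℂ) + ((-(Δ / (2 * E)) : ℝ) : ℂ) = 0 := by exact_mod_cast h1
  have h2' : (E : ℂ) * (((Δ / (2 * E) : ℝ) : ℂ) - ((-(Δ / (2 * E)) : ℝ) : ℂ)) = Δ := by exact_mod_cast h2
  rw [h1', h2', mul_zero, zero_add]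

/-- The Nambu propagator is symmetric in the off-diagonal: `G₂₁ = G₁₂`. [folklore] -/
theorem nambuPropagator_apply_one_zero (β μ h : ℝ) (k : FreqMomentum L M) :
    nambuPropagator L M β μ h k 1 0 = nambuPropagator L M β μ h k 0 1 := by
  rw [(nambuPropagator_apply β μ h k).2.1, (nambuPropagator_apply β μ h k).2.2.1]

end Algebra

/-! ### Weighted pairs of one-mode propagators: limits and bounds -/

/-- Linearity: the truncated sum of a weighted pair is the weighted pair of truncated sums. [folklore] -/
theorem weightedPair_split (β E a b τ : ℝ) (M : ℕ) :
    (1 / (β : ℂ)) * ∑ i : MatsubaraIdx M, cexp (-(I * matsubaraFreq β M i * τ)) *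
        ((a : ℂ) * (1 / (-(I * matsubaraFreq β M i) + E)) + (b : ℂ) * (1 / (-(I * matsubaraFreq β M i) + ((-E : ℝ) : ℂ)))) =
      (a : ℂ) * ((1 / (β : ℂ)) * ∑ i : MatsubaraIdx M, cexp (-(I * matsubaraFreq β M i * τ)) *
        (1 / (-(I * matsubaraFreq β M i) + E))) +
      (b : ℂ) * ((1 / (β : ℂ)) * ∑ i : MatsubaraIdx M, cexp (-(I * matsubaraFreq β M i * τ)) *
        (1 / (-(I * matsubaraFreq β M i) + ((-E : ℝ) : ℂ)))) := by
  rw [Finset.mul_sum, Finset.mul_sum, Finset.mul_sum, Finset.mul_sum, Finset.mul_sum, ← Finset.sum_add_distrib]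
  refine Finset.sum_congr rfl fun i _ => ?_
  ring

/-- **Limit of a weighted pair, `0 < τ < β`**:
`(1/β) Σᵢ e^{-iωᵢτ}(a/(-iωᵢ + E) + b/(-iωᵢ − E)) → a (1 + e^{-βE})⁻¹ e^{-Eτ} + b (1 + e^{βE})⁻¹ e^{Eτ}`.
[cite: BenfattoGiulianiMastropietro2006, §2.1 (2.3)-(2.4)] -/
theorem tendsto_weightedPair_bgm_of_mem_Ioo {β : ℝ} (hβ : 0 < β) (E a b : ℝ) {τ : ℝ} (hτ : τ ∈ Set.Ioo 0 β) :
    Tendsto (fun M : ℕ => (1 / (β : ℂ)) * ∑ i : MatsubaraIdx M, cexp (-(I * matsubaraFreq β M i * τ)) *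
        ((a : ℂ) * (1 / (-(I * matsubaraFreq β M i) + E)) + (b : ℂ) * (1 / (-(I * matsubaraFreq β M i) + ((-E : ℝ) : ℂ)))))
      atTop (𝓝 ((a * ((1 + Real.exp (-(β * E)))⁻¹ * Real.exp (-(E * τ))) +
        b * ((1 + Real.exp (β * E))⁻¹ * Real.exp (E * τ)) : ℝ) : ℂ)) := by
  have h1 := (tendsto_truncatedPropagator_bgm_of_mem_Ioo hβ E hτ).const_mul (a : ℂ)
  have h2 := (tendsto_truncatedPropagator_bgm_of_mem_Ioo hβ (-E) hτ).const_mul (b : ℂ)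
  have h := h1.add h2
  have hval : (a : ℂ) * ((((1 + Real.exp (-(β * E)))⁻¹ * Real.exp (-(E * τ))) : ℝ) : ℂ) +
      (b : ℂ) * ((((1 + Real.exp (-(β * -E)))⁻¹ * Real.exp (-(-E * τ))) : ℝ) : ℂ) =
      ((a * ((1 + Real.exp (-(β * E)))⁻¹ * Real.exp (-(E * τ))) +
        b * ((1 + Real.exp (β * E))⁻¹ * Real.exp (E * τ)) : ℝ) : ℂ) := by
    push_cast
    ring_nf
  rw [hval] at h
  refine h.congr fun M => ?_
  rw [weightedPair_split]

/-- **Limit of a weighted pair, `-β < τ < 0`**: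
`(1/β) Σᵢ e^{-iωᵢτ}(a/(-iωᵢ + E) + b/(-iωᵢ − E)) → -(a (1 + e^{βE})⁻¹ e^{-Eτ} + b (1 + e^{-βE})⁻¹ e^{Eτ})`.
[cite: BenfattoGiulianiMastropietro2006, §2.1 (2.3)-(2.4)] -/
theorem tendsto_weightedPair_bgm_of_mem_Ioo_neg {β : ℝ} (hβ : 0 < β) (E a b : ℝ) {τ : ℝ}
    (hτ : τ ∈ Set.Ioo (-β) 0) :
    Tendsto (fun M : ℕ => (1 / (β : ℂ)) * ∑ i : MatsubaraIdx M, cexp (-(I * matsubaraFreq β M i * τ)) *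
        ((a : ℂ) * (1 / (-(I * matsubaraFreq β M i) + E)) + (b : ℂ) * (1 / (-(I * matsubaraFreq β M i) + ((-E : ℝ) : ℂ)))))
      atTop (𝓝 ((-(a * ((1 + Real.exp (β * E))⁻¹ * Real.exp (-(E * τ))) +
        b * ((1 + Real.exp (-(β * E)))⁻¹ * Real.exp (E * τ))) : ℝ) : ℂ)) := by
  have h1 := (tendsto_truncatedPropagator_bgm_of_mem_Ioo_neg hβ E hτ).const_mul (a : ℂ)
  have h2 := (tendsto_truncatedPropagator_bgm_of_mem_Ioo_neg hβ (-E) hτ).const_mul (b : ℂ)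
  have h := h1.add h2
  have hval : (a : ℂ) * (((-((1 + Real.exp (β * E))⁻¹ * Real.exp (-(E * τ)))) : ℝ) : ℂ) +
      (b : ℂ) * (((-((1 + Real.exp (β * -E))⁻¹ * Real.exp (-(-E * τ)))) : ℝ) : ℂ) =
      ((-(a * ((1 + Real.exp (β * E))⁻¹ * Real.exp (-(E * τ))) +
        b * ((1 + Real.exp (-(β * E)))⁻¹ * Real.exp (E * τ))) : ℝ) : ℂ) := by
    push_cast
    ring_nf
  rw [hval] at h
  refine h.congr fun M => ?_
  rw [weightedPair_split]

/-- **Uniform bound of a weighted pair**: `‖(1/β) Σᵢ e^{-iωᵢτ}(a/(-iωᵢ + E) + b/(-iωᵢ − E))‖ ≤ (|a| + |b|)(2 + β|E|/3)`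
for all `M`, `τ`. [folklore] -/
theorem norm_weightedPair_bgm_le {β : ℝ} (hβ : 0 < β) (E a b τ : ℝ) (M : ℕ) :
    ‖(1 / (β : ℂ)) * ∑ i : MatsubaraIdx M, cexp (-(I * matsubaraFreq β M i * τ)) *
        ((a : ℂ) * (1 / (-(I * matsubaraFreq β M i) + E)) + (b : ℂ) * (1 / (-(I * matsubaraFreq β M i) + ((-E : ℝ) : ℂ))))‖ ≤
      (|a| + |b|) * (2 + β * |E| / 3) := by
  rw [weightedPair_split]
  have ha := norm_truncatedPropagator_bgm_le hβ E τ M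
  have hb := norm_truncatedPropagator_bgm_le hβ (-E) τ M
  rw [abs_neg] at hb
  have hA : ‖(a : ℂ) * ((1 / (β : ℂ)) * ∑ i : MatsubaraIdx M, cexp (-(I * matsubaraFreq β M i * τ)) *
      (1 / (-(I * matsubaraFreq β M i) + E)))‖ ≤ |a| * (2 + β * |E| / 3) := by
    rw [norm_mul, Complex.norm_real, Real.norm_eq_abs]
    exact mul_le_mul_of_nonneg_left ha (abs_nonneg a)
  have hB : ‖(b : ℂ) * ((1 / (β : ℂ)) * ∑ i : MatsubaraIdx M, cexp (-(I * matsubaraFreq β M i * τ)) *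
      (1 / (-(I * matsubaraFreq β M i) + ((-E : ℝ) : ℂ))))‖ ≤ |b| * (2 + β * |E| / 3) := by
    rw [norm_mul, Complex.norm_real, Real.norm_eq_abs]
    exact mul_le_mul_of_nonneg_left hb (abs_nonneg b)
  calc _ ≤ _ := norm_add_le _ _
    _ ≤ |a| * (2 + β * |E| / 3) + |b| * (2 + β * |E| / 3) := add_le_add hA hB
    _ = (|a| + |b|) * (2 + β * |E| / 3) := by ring

/-! ### The entries of the seeded propagator: bounded convergence of the truncated frequency sums -/

section Entries

variable {L : ℕ}

/-- The BCS weights are bounded: `|½(1 ± ξ/E)| ≤ 1` (`E = √(ξ² + Δ²) ≥ |ξ|`). [folklore] -/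
theorem abs_bcsWeight_le_one (ξ Δ : ℝ) (s : ℝ) (hs : s = 1 ∨ s = -1) :
    |(1 + s * (ξ / Real.sqrt (ξ ^ 2 + Δ ^ 2))) / 2| ≤ 1 := by
  have hq : |ξ / Real.sqrt (ξ ^ 2 + Δ ^ 2)| ≤ 1 := by
    rcases eq_or_ne (Real.sqrt (ξ ^ 2 + Δ ^ 2)) 0 with h0 | h0
    · rw [h0, div_zero, abs_zero]; exact zero_le_one
    · have hpos : 0 < Real.sqrt (ξ ^ 2 + Δ ^ 2) := lt_of_le_of_ne (Real.sqrt_nonneg _) h0.symm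
      rw [abs_div, abs_of_pos hpos, div_le_one hpos]
      calc |ξ| = Real.sqrt (ξ ^ 2) := (Real.sqrt_sq_eq_abs ξ).symm
        _ ≤ Real.sqrt (ξ ^ 2 + Δ ^ 2) := Real.sqrt_le_sqrt (by nlinarith [sq_nonneg Δ])
  have hsq : |s * (ξ / Real.sqrt (ξ ^ 2 + Δ ^ 2))| ≤ 1 := by
    rw [abs_mul]
    rcases hs with rfl | rfl <;> simp [hq]
  rw [abs_le] at hsq ⊢
  constructor <;> linarith [hsq.1, hsq.2]

/-- The anomalous weight is bounded: `|Δ/(2E)| ≤ 1/2`. [folklore] -/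
theorem abs_anomalousWeight_le (ξ Δ : ℝ) : |Δ / (2 * Real.sqrt (ξ ^ 2 + Δ ^ 2))| ≤ 1 / 2 := by
  rcases eq_or_ne (Real.sqrt (ξ ^ 2 + Δ ^ 2)) 0 with h0 | h0
  · rw [h0, mul_zero, div_zero, abs_zero]; norm_num
  · have hpos : 0 < Real.sqrt (ξ ^ 2 + Δ ^ 2) := lt_of_le_of_ne (Real.sqrt_nonneg _) h0.symm
    rw [abs_div, abs_mul, abs_two, abs_of_pos hpos, div_le_div_iff₀ (by positivity) two_pos, one_mul]
    calc |Δ| * 2 = 2 * Real.sqrt (Δ ^ 2) := by rw [Real.sqrt_sq_eq_abs]; ring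
      _ ≤ 2 * Real.sqrt (ξ ^ 2 + Δ ^ 2) := by gcongr; nlinarith [sq_nonneg ξ]

/-- **`G₁₁`: bounded convergence to the BCS two-point function, `0 < τ < β`**:
`(1/β) Σᵢ e^{-iωᵢτ} G₁₁(ωᵢ, k⃗) → u²(1 + e^{-βE})⁻¹e^{-Eτ} + v²(1 + e^{βE})⁻¹e^{Eτ}`
(`= u²(1 − n_F(E))e^{-Eτ} + v² n_F(E) e^{Eτ} = ⟨a_{k↑}(τ) a⁺_{k↑}(0)⟩_{BdG}`). [cite: BenfattoGiulianiMastropietro2006, §2.1 (2.3)-(2.4)] -/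
theorem tendsto_nambuPropagator_zero_zero_of_mem_Ioo {β : ℝ} (hβ : 0 < β) (μ h : ℝ) (p : TorusSite 2 L) {τ : ℝ}
    (hτ : τ ∈ Set.Ioo 0 β) :
    Tendsto (fun M : ℕ => (1 / (β : ℂ)) * ∑ i : MatsubaraIdx M, cexp (-(I * matsubaraFreq β M i * τ)) *
        nambuPropagator L M β μ h (i, p) 0 0)
      atTop (𝓝 (((1 + nambuXi L μ p / Real.sqrt (nambuXi L μ p ^ 2 + (h * dWaveSymbol L p) ^ 2)) / 2 *
          ((1 + Real.exp (-(β * Real.sqrt (nambuXi L μ p ^ 2 + (h * dWaveSymbol L p) ^ 2))))⁻¹ *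
            Real.exp (-(Real.sqrt (nambuXi L μ p ^ 2 + (h * dWaveSymbol L p) ^ 2) * τ))) +
        (1 - nambuXi L μ p / Real.sqrt (nambuXi L μ p ^ 2 + (h * dWaveSymbol L p) ^ 2)) / 2 *
          ((1 + Real.exp (β * Real.sqrt (nambuXi L μ p ^ 2 + (h * dWaveSymbol L p) ^ 2)))⁻¹ *
            Real.exp (Real.sqrt (nambuXi L μ p ^ 2 + (h * dWaveSymbol L p) ^ 2) * τ)) : ℝ) : ℂ)) := by
  refine (tendsto_weightedPair_bgm_of_mem_Ioo hβ _ _ _ hτ).congr fun M => ?_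
  congr 1
  refine Finset.sum_congr rfl fun i _ => ?_
  rw [nambuPropagator_apply_zero_zero hβ.ne' μ h (i, p)]

/-- **`G₁₁`, `-β < τ < 0`**: the limit is `-(u²(1 + e^{βE})⁻¹e^{-Eτ} + v²(1 + e^{-βE})⁻¹e^{Eτ})`
(`= -⟨a⁺_{k↑}(0) a_{k↑}(τ)⟩_{BdG}`). [cite: BenfattoGiulianiMastropietro2006, §2.1 (2.3)-(2.4)] -/
theorem tendsto_nambuPropagator_zero_zero_of_mem_Ioo_neg {β : ℝ} (hβ : 0 < β) (μ h : ℝ) (p : TorusSite 2 L) {τ : ℝ}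
    (hτ : τ ∈ Set.Ioo (-β) 0) :
    Tendsto (fun M : ℕ => (1 / (β : ℂ)) * ∑ i : MatsubaraIdx M, cexp (-(I * matsubaraFreq β M i * τ)) *
        nambuPropagator L M β μ h (i, p) 0 0)
      atTop (𝓝 ((-((1 + nambuXi L μ p / Real.sqrt (nambuXi L μ p ^ 2 + (h * dWaveSymbol L p) ^ 2)) / 2 *
          ((1 + Real.exp (β * Real.sqrt (nambuXi L μ p ^ 2 + (h * dWaveSymbol L p) ^ 2)))⁻¹ *
            Real.exp (-(Real.sqrt (nambuXi L μ p ^ 2 + (h * dWaveSymbol L p) ^ 2) * τ))) +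
        (1 - nambuXi L μ p / Real.sqrt (nambuXi L μ p ^ 2 + (h * dWaveSymbol L p) ^ 2)) / 2 *
          ((1 + Real.exp (-(β * Real.sqrt (nambuXi L μ p ^ 2 + (h * dWaveSymbol L p) ^ 2))))⁻¹ *
            Real.exp (Real.sqrt (nambuXi L μ p ^ 2 + (h * dWaveSymbol L p) ^ 2) * τ))) : ℝ) : ℂ)) := by
  refine (tendsto_weightedPair_bgm_of_mem_Ioo_neg hβ _ _ _ hτ).congr fun M => ?_
  congr 1
  refine Finset.sum_congr rfl fun i _ => ?_
  rw [nambuPropagator_apply_zero_zero hβ.ne' μ h (i, p)]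

/-- **`G₂₂`, `0 < τ < β`**: `(1/β) Σᵢ e^{-iωᵢτ} G₂₂(ωᵢ, k⃗) → v²(1 + e^{-βE})⁻¹e^{-Eτ} + u²(1 + e^{βE})⁻¹e^{Eτ}`.
[cite: BenfattoGiulianiMastropietro2006, §2.1 (2.3)-(2.4)] -/
theorem tendsto_nambuPropagator_one_one_of_mem_Ioo {β : ℝ} (hβ : 0 < β) (μ h : ℝ) (p : TorusSite 2 L) {τ : ℝ}
    (hτ : τ ∈ Set.Ioo 0 β) :
    Tendsto (fun M : ℕ => (1 / (β : ℂ)) * ∑ i : MatsubaraIdx M, cexp (-(I * matsubaraFreq β M i * τ)) *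
        nambuPropagator L M β μ h (i, p) 1 1)
      atTop (𝓝 (((1 - nambuXi L μ p / Real.sqrt (nambuXi L μ p ^ 2 + (h * dWaveSymbol L p) ^ 2)) / 2 *
          ((1 + Real.exp (-(β * Real.sqrt (nambuXi L μ p ^ 2 + (h * dWaveSymbol L p) ^ 2))))⁻¹ *
            Real.exp (-(Real.sqrt (nambuXi L μ p ^ 2 + (h * dWaveSymbol L p) ^ 2) * τ))) +
        (1 + nambuXi L μ p / Real.sqrt (nambuXi L μ p ^ 2 + (h * dWaveSymbol L p) ^ 2)) / 2 *
          ((1 + Real.exp (β * Real.sqrt (nambuXi L μ p ^ 2 + (h * dWaveSymbol L p) ^ 2)))⁻¹ *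
            Real.exp (Real.sqrt (nambuXi L μ p ^ 2 + (h * dWaveSymbol L p) ^ 2) * τ)) : ℝ) : ℂ)) := by
  refine (tendsto_weightedPair_bgm_of_mem_Ioo hβ _ _ _ hτ).congr fun M => ?_
  congr 1
  refine Finset.sum_congr rfl fun i _ => ?_
  rw [nambuPropagator_apply_one_one hβ.ne' μ h (i, p)]

/-- **`G₂₂`, `-β < τ < 0`**. [cite: BenfattoGiulianiMastropietro2006, §2.1 (2.3)-(2.4)] -/
theorem tendsto_nambuPropagator_one_one_of_mem_Ioo_neg {β : ℝ} (hβ : 0 < β) (μ h : ℝ) (p : TorusSite 2 L) {τ : ℝ}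
    (hτ : τ ∈ Set.Ioo (-β) 0) :
    Tendsto (fun M : ℕ => (1 / (β : ℂ)) * ∑ i : MatsubaraIdx M, cexp (-(I * matsubaraFreq β M i * τ)) *
        nambuPropagator L M β μ h (i, p) 1 1)
      atTop (𝓝 ((-((1 - nambuXi L μ p / Real.sqrt (nambuXi L μ p ^ 2 + (h * dWaveSymbol L p) ^ 2)) / 2 *
          ((1 + Real.exp (β * Real.sqrt (nambuXi L μ p ^ 2 + (h * dWaveSymbol L p) ^ 2)))⁻¹ *
            Real.exp (-(Real.sqrt (nambuXi L μ p ^ 2 + (h * dWaveSymbol L p) ^ 2) * τ))) +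
        (1 + nambuXi L μ p / Real.sqrt (nambuXi L μ p ^ 2 + (h * dWaveSymbol L p) ^ 2)) / 2 *
          ((1 + Real.exp (-(β * Real.sqrt (nambuXi L μ p ^ 2 + (h * dWaveSymbol L p) ^ 2))))⁻¹ *
            Real.exp (Real.sqrt (nambuXi L μ p ^ 2 + (h * dWaveSymbol L p) ^ 2) * τ))) : ℝ) : ℂ)) := by
  refine (tendsto_weightedPair_bgm_of_mem_Ioo_neg hβ _ _ _ hτ).congr fun M => ?_
  congr 1
  refine Finset.sum_congr rfl fun i _ => ?_
  rw [nambuPropagator_apply_one_one hβ.ne' μ h (i, p)]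

/-- **The anomalous entry `G₁₂ = G₂₁`, `0 < τ < β`**:
`(1/β) Σᵢ e^{-iωᵢτ} G₁₂(ωᵢ, k⃗) → (Δ/2E)((1 + e^{-βE})⁻¹e^{-Eτ} − (1 + e^{βE})⁻¹e^{Eτ})` (the anomalous
imaginary-time function `⟨a_{k↑}(τ) a_{-k↓}(0)⟩_{BdG}`). [cite: BenfattoGiulianiMastropietro2006, §2.1 (2.3)-(2.4)] -/
theorem tendsto_nambuPropagator_zero_one_of_mem_Ioo {β : ℝ} (hβ : 0 < β) (μ h : ℝ) (p : TorusSite 2 L) {τ : ℝ}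
    (hτ : τ ∈ Set.Ioo 0 β) :
    Tendsto (fun M : ℕ => (1 / (β : ℂ)) * ∑ i : MatsubaraIdx M, cexp (-(I * matsubaraFreq β M i * τ)) *
        nambuPropagator L M β μ h (i, p) 0 1)
      atTop (𝓝 ((h * dWaveSymbol L p / (2 * Real.sqrt (nambuXi L μ p ^ 2 + (h * dWaveSymbol L p) ^ 2)) *
          ((1 + Real.exp (-(β * Real.sqrt (nambuXi L μ p ^ 2 + (h * dWaveSymbol L p) ^ 2))))⁻¹ *
            Real.exp (-(Real.sqrt (nambuXi L μ p ^ 2 + (h * dWaveSymbol L p) ^ 2) * τ))) +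
        -(h * dWaveSymbol L p / (2 * Real.sqrt (nambuXi L μ p ^ 2 + (h * dWaveSymbol L p) ^ 2))) *
          ((1 + Real.exp (β * Real.sqrt (nambuXi L μ p ^ 2 + (h * dWaveSymbol L p) ^ 2)))⁻¹ *
            Real.exp (Real.sqrt (nambuXi L μ p ^ 2 + (h * dWaveSymbol L p) ^ 2) * τ)) : ℝ) : ℂ)) := by
  refine (tendsto_weightedPair_bgm_of_mem_Ioo hβ _ _ _ hτ).congr fun M => ?_
  congr 1
  refine Finset.sum_congr rfl fun i _ => ?_
  rw [nambuPropagator_apply_zero_one hβ.ne' μ h (i, p)]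

/-- **The anomalous entry, `-β < τ < 0`**. [cite: BenfattoGiulianiMastropietro2006, §2.1 (2.3)-(2.4)] -/
theorem tendsto_nambuPropagator_zero_one_of_mem_Ioo_neg {β : ℝ} (hβ : 0 < β) (μ h : ℝ) (p : TorusSite 2 L) {τ : ℝ}
    (hτ : τ ∈ Set.Ioo (-β) 0) :
    Tendsto (fun M : ℕ => (1 / (β : ℂ)) * ∑ i : MatsubaraIdx M, cexp (-(I * matsubaraFreq β M i * τ)) *
        nambuPropagator L M β μ h (i, p) 0 1)
      atTop (𝓝 ((-((h * dWaveSymbol L p / (2 * Real.sqrt (nambuXi L μ p ^ 2 + (h * dWaveSymbol L p) ^ 2))) *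
          ((1 + Real.exp (β * Real.sqrt (nambuXi L μ p ^ 2 + (h * dWaveSymbol L p) ^ 2)))⁻¹ *
            Real.exp (-(Real.sqrt (nambuXi L μ p ^ 2 + (h * dWaveSymbol L p) ^ 2) * τ))) +
        -(h * dWaveSymbol L p / (2 * Real.sqrt (nambuXi L μ p ^ 2 + (h * dWaveSymbol L p) ^ 2))) *
          ((1 + Real.exp (-(β * Real.sqrt (nambuXi L μ p ^ 2 + (h * dWaveSymbol L p) ^ 2))))⁻¹ *
            Real.exp (Real.sqrt (nambuXi L μ p ^ 2 + (h * dWaveSymbol L p) ^ 2) * τ))) : ℝ) : ℂ)) := by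
  refine (tendsto_weightedPair_bgm_of_mem_Ioo_neg hβ _ _ _ hτ).congr fun M => ?_
  congr 1
  refine Finset.sum_congr rfl fun i _ => ?_
  rw [nambuPropagator_apply_zero_one hβ.ne' μ h (i, p)]

/-- The common shape of the entry bounds: weights with `|a| + |b| ≤ 2`. [folklore] -/
theorem norm_weightedPair_bgm_le_two {β : ℝ} (hβ : 0 < β) (ξ Δ a b τ : ℝ) (M : ℕ) (hab : |a| + |b| ≤ 2) :
    ‖(1 / (β : ℂ)) * ∑ i : MatsubaraIdx M, cexp (-(I * matsubaraFreq β M i * τ)) *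
        ((a : ℂ) * (1 / (-(I * matsubaraFreq β M i) + Real.sqrt (ξ ^ 2 + Δ ^ 2))) +
          (b : ℂ) * (1 / (-(I * matsubaraFreq β M i) + ((-Real.sqrt (ξ ^ 2 + Δ ^ 2) : ℝ) : ℂ))))‖ ≤
      2 * (2 + β * Real.sqrt (ξ ^ 2 + Δ ^ 2) / 3) := by
  refine (norm_weightedPair_bgm_le hβ _ a b τ M).trans ?_
  rw [abs_of_nonneg (Real.sqrt_nonneg _)]
  exact mul_le_mul_of_nonneg_right hab (by positivity)

/-- **Uniform bound, `G₁₁`**: `‖(1/β) Σᵢ e^{-iωᵢτ} G₁₁(ωᵢ, k⃗)‖ ≤ 2(2 + βE/3)` for all `M`, `τ`. [folklore] -/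
theorem norm_nambuPropagator_zero_zero_sum_le {β : ℝ} (hβ : 0 < β) (μ h τ : ℝ) (p : TorusSite 2 L) (M : ℕ) :
    ‖(1 / (β : ℂ)) * ∑ i : MatsubaraIdx M, cexp (-(I * matsubaraFreq β M i * τ)) *
        nambuPropagator L M β μ h (i, p) 0 0‖ ≤
      2 * (2 + β * Real.sqrt (nambuXi L μ p ^ 2 + (h * dWaveSymbol L p) ^ 2) / 3) := by
  set ξ := nambuXi L μ p with hξ
  set Δ := h * dWaveSymbol L p with hΔ
  set E := Real.sqrt (ξ ^ 2 + Δ ^ 2) with hE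
  have hu := abs_bcsWeight_le_one ξ Δ 1 (Or.inl rfl)
  have hv := abs_bcsWeight_le_one ξ Δ (-1) (Or.inr rfl)
  rw [one_mul] at hu
  rw [neg_one_mul, ← sub_eq_add_neg] at hv
  have hrw : ∀ i : MatsubaraIdx M, nambuPropagator L M β μ h (i, p) 0 0 =
      (((1 + ξ / E) / 2 : ℝ) : ℂ) * (1 / (-(I * matsubaraFreq β M i) + E)) +
        (((1 - ξ / E) / 2 : ℝ) : ℂ) * (1 / (-(I * matsubaraFreq β M i) + ((-E : ℝ) : ℂ))) :=
    fun i => nambuPropagator_apply_zero_zero hβ.ne' μ h (i, p)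
  rw [Finset.sum_congr rfl fun i _ => by rw [hrw i]]
  exact norm_weightedPair_bgm_le_two hβ ξ Δ ((1 + ξ / E) / 2) ((1 - ξ / E) / 2) τ M (by linarith)

/-- **Uniform bound, `G₂₂`**. [folklore] -/
theorem norm_nambuPropagator_one_one_sum_le {β : ℝ} (hβ : 0 < β) (μ h τ : ℝ) (p : TorusSite 2 L) (M : ℕ) :
    ‖(1 / (β : ℂ)) * ∑ i : MatsubaraIdx M, cexp (-(I * matsubaraFreq β M i * τ)) *
        nambuPropagator L M β μ h (i, p) 1 1‖ ≤
      2 * (2 + β * Real.sqrt (nambuXi L μ p ^ 2 + (h * dWaveSymbol L p) ^ 2) / 3) := by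
  set ξ := nambuXi L μ p with hξ
  set Δ := h * dWaveSymbol L p with hΔ
  set E := Real.sqrt (ξ ^ 2 + Δ ^ 2) with hE
  have hu := abs_bcsWeight_le_one ξ Δ 1 (Or.inl rfl)
  have hv := abs_bcsWeight_le_one ξ Δ (-1) (Or.inr rfl)
  rw [one_mul] at hu
  rw [neg_one_mul, ← sub_eq_add_neg] at hv
  have hrw : ∀ i : MatsubaraIdx M, nambuPropagator L M β μ h (i, p) 1 1 =
      (((1 - ξ / E) / 2 : ℝ) : ℂ) * (1 / (-(I * matsubaraFreq β M i) + E)) +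
        (((1 + ξ / E) / 2 : ℝ) : ℂ) * (1 / (-(I * matsubaraFreq β M i) + ((-E : ℝ) : ℂ))) :=
    fun i => nambuPropagator_apply_one_one hβ.ne' μ h (i, p)
  rw [Finset.sum_congr rfl fun i _ => by rw [hrw i]]
  exact norm_weightedPair_bgm_le_two hβ ξ Δ ((1 - ξ / E) / 2) ((1 + ξ / E) / 2) τ M (by linarith)

/-- **Uniform bound, `G₁₂`** (and `G₂₁ = G₁₂`, `nambuPropagator_apply_one_zero`). [folklore] -/
theorem norm_nambuPropagator_zero_one_sum_le {β : ℝ} (hβ : 0 < β) (μ h τ : ℝ) (p : TorusSite 2 L) (M : ℕ) :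
    ‖(1 / (β : ℂ)) * ∑ i : MatsubaraIdx M, cexp (-(I * matsubaraFreq β M i * τ)) *
        nambuPropagator L M β μ h (i, p) 0 1‖ ≤
      2 * (2 + β * Real.sqrt (nambuXi L μ p ^ 2 + (h * dWaveSymbol L p) ^ 2) / 3) := by
  set ξ := nambuXi L μ p with hξ
  set Δ := h * dWaveSymbol L p with hΔ
  set E := Real.sqrt (ξ ^ 2 + Δ ^ 2) with hE
  have hw := abs_anomalousWeight_le ξ Δ
  have hrw : ∀ i : MatsubaraIdx M, nambuPropagator L M β μ h (i, p) 0 1 =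
      ((Δ / (2 * E) : ℝ) : ℂ) * (1 / (-(I * matsubaraFreq β M i) + E)) +
        ((-(Δ / (2 * E)) : ℝ) : ℂ) * (1 / (-(I * matsubaraFreq β M i) + ((-E : ℝ) : ℂ))) :=
    fun i => nambuPropagator_apply_zero_one hβ.ne' μ h (i, p)
  rw [Finset.sum_congr rfl fun i _ => by rw [hrw i]]
  exact norm_weightedPair_bgm_le_two hβ ξ Δ (Δ / (2 * E)) (-(Δ / (2 * E))) τ M (by rw [abs_neg]; linarith)

end Entries

end Literature.MathematicalPhysics.QuantumLattice
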